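import Literature.Computability.Complexity.GaussIntegralFP
import Literature.Computability.QuantumComplexity.GroverRudolph
import HarnessLib

/-!
# Gaussian cell weights on a register of `ℓ` bits and their prefix masses in closed form

Topic `Literature/Computability/QuantumComplexity`, sequel of `GroverRudolph.lean` (state preparation
from prefix masses) and `Complexity/GaussIntegralFP.lean` (the Gaussian integral `G(c, x) = ∫₀ˣ e^{-ct²}dt`
to any dyadic precision). The one-dimensional Gaussian state of Regev's quantum sampler (Regev 2009,
Lemma 3.12, eq. (10): `Σ_{x=-√n r}^{√n r} e^{-π(x/(√2 r))²} |x⟩`, "created using a technique by Grover and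
Rudolph … it suffices to be able to compute … `Σ_{x=a}^b e^{-π(x/r)²}` to within good precision") is
prepared in the tree as the qsample of the **cell weights**

  `w(y) = ∫_{u}^{u+1} e^{-c t²} dt`,  `u = v(y) − 2^{ℓ-1} ∈ [−2^{ℓ-1}, 2^{ℓ-1})`,  `c = π/S`,

of the integer points `u` coded by the labels `y : Fin ℓ → Bool` (`v(y)` the binary value, most
significant bit first), i.e. of the continuous Gaussian of parameter `√S` floored to the integers — a
distribution whose prefix masses are EXACT differences of `G(c, ·)` at the two ends of a dyadic interval
(integrals are additive), so that the Grover–Rudolph conditional probabilities are ratios of values a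
machine computes with `GaussIntegral.gaussFApprox`. This file sets this up, for any parameter `c`:

* `GaussianCells.hiVal j y = Σ_{i<j} [y i] 2^{j-1-i}` — the value of the first `j` bits (`hiVal_zero`,
  the shift recursion `hiVal_succ`, independence of the later bits `hiVal_update`), `binVal = hiVal ℓ`
  (`< 2^ℓ`);
* `GaussianCells.cellW ℓ c y = G(c, u+1) − G(c, u)`, `u = binVal y − 2^{ℓ-1}` (`cellW_eq_integral`,
  `cellW_pos` for `c ≥ 0`… positivity holds for every real `c`);
* **`GaussianCells.prefW_cellW`** — the prefix mass in closed form, for `j ≤ ℓ`: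
  `prefW (cellW ℓ c) j y = G(c, lo + 2^{ℓ-j} − 2^{ℓ-1}) − G(c, lo − 2^{ℓ-1})`, `lo = hiVal j y · 2^{ℓ-j}`
  — by DOWNWARD induction on the level: both sides satisfy the splitting `p(b) = p(b0) + p(b1)`
  (`GroverRudolph.prefW_succ`; on the right the two half-intervals telescope), and agree at level `ℓ`;
  in particular `total (cellW ℓ c) = G(c, 2^{ℓ-1}) − G(c, −2^{ℓ-1})` (`total_cellW`), positive.

Everything here is proved; definitions have bodies; no named fact is introduced. The tail estimates,
the comparison with the point Gaussian `e^{-cu²}` and the machine's rounded angles are the sequels.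

## References

* O. Regev, *On lattices, learning with errors, random linear codes, and cryptography*, J. ACM 56
  (2009), art. 34, Lemma 3.12 (proof, eq. (10)) [Regev2009].
* L. Grover, T. Rudolph, *Creating superpositions that correspond to efficiently integrable probability
  distributions*, arXiv:quant-ph/0208112 (2002) [GroverRudolph2002].
* D. E. Knuth, *The Art of Computer Programming*, Vol. 2, 3rd ed., 1998, §4.1 (positional number
  systems) [KnuthTAOCP2].
-/

noncomputable section

namespace Literature.Computability.QuantumComplexity

open Finset Literature.Computability.Complexity Literature.Computability.Complexity.GaussIntegral GroverRudolph

namespace GaussianCells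

variable {ℓ : ℕ}

/-! ### Values of bit vectors, most significant bit first -/

/-- **The value of the first `j` bits** (bit `0` most significant): `Σ_{i<j} [y i] 2^{j-1-i}`. [cite: KnuthTAOCP2, §4.1] -/
def hiVal (j : ℕ) (y : Fin ℓ → Bool) : ℕ := ∑ i : Fin ℓ, if y i = true ∧ (i : ℕ) < j then 2 ^ (j - 1 - i) else 0

/-- **The binary value** of the whole label. [cite: KnuthTAOCP2, §4.1] -/
def binVal (y : Fin ℓ → Bool) : ℕ := hiVal ℓ y

/-- No bits, value `0`. [folklore] -/
@[simp] theorem hiVal_zero (y : Fin ℓ → Bool) : hiVal 0 y = 0 := by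
  unfold hiVal; exact sum_eq_zero fun i _ => if_neg fun h => Nat.not_lt_zero _ h.2

/-- **Shift recursion**: `hiVal (j+1) y = 2·hiVal j y + [y j]` (`j < ℓ`). [cite: KnuthTAOCP2, §4.1 (Horner)] -/
theorem hiVal_succ (j : Fin ℓ) (y : Fin ℓ → Bool) : hiVal (j + 1) y = 2 * hiVal j y + (if y j then 1 else 0) := by
  unfold hiVal
  rw [mul_sum, ← Finset.sum_erase_add _ _ (mem_univ j)]
  have hlast : (if y j = true ∧ (j : ℕ) < (j : ℕ) + 1 then 2 ^ ((j : ℕ) + 1 - 1 - j) else 0) = (if y j then 1 else 0) := by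
    by_cases hy : y j = true
    · rw [if_pos ⟨hy, Nat.lt_succ_self _⟩, if_pos hy]; simp
    · rw [if_neg (fun h => hy h.1), if_neg hy]
  rw [hlast]
  congr 1
  rw [← Finset.sum_erase_add univ (fun i : Fin ℓ => 2 * (if y i = true ∧ (i : ℕ) < j then 2 ^ ((j : ℕ) - 1 - i) else 0)) (mem_univ j)]
  have hjj : 2 * (if y j = true ∧ (j : ℕ) < (j : ℕ) then 2 ^ ((j : ℕ) - 1 - j) else 0) = 0 := by rw [if_neg (fun h => lt_irrefl _ h.2)]
  rw [hjj, add_zero]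
  refine sum_congr rfl fun i hi => ?_
  have hij : (i : ℕ) ≠ j := fun e => (ne_of_mem_erase hi) (Fin.ext e)
  by_cases hy : y i = true
  · simp only [hy, true_and]
    by_cases hlt : (i : ℕ) < j
    · rw [if_pos (by omega), if_pos hlt, show (j : ℕ) + 1 - 1 - i = ((j : ℕ) - 1 - i) + 1 by omega, pow_succ]; ring
    · rw [if_neg (by omega), if_neg hlt, mul_zero]
  · rw [if_neg (fun h => hy h.1), if_neg (fun h => hy h.1), mul_zero]

/-- The value of the first `j` bits does not read the later bits. [folklore] -/
theorem hiVal_update {j : ℕ} (j' : Fin ℓ) (hjj : j ≤ j') (y : Fin ℓ → Bool) (b : Bool) :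
    hiVal j (Function.update y j' b) = hiVal j y := by
  unfold hiVal
  refine sum_congr rfl fun i _ => ?_
  by_cases hi : (i : ℕ) < j
  · rw [Function.update_of_ne (by intro e; subst e; omega)]
  · rw [if_neg (fun h => hi h.2), if_neg (fun h => hi h.2)]

/-- The value of the first `j` bits depends only on them. [folklore] -/
theorem hiVal_congr {j : ℕ} {y y' : Fin ℓ → Bool} (h : AgreeBelow j y y') : hiVal j y' = hiVal j y := by
  unfold hiVal
  refine sum_congr rfl fun i _ => ?_
  by_cases hi : (i : ℕ) < j
  · rw [h i hi]
  · rw [if_neg (fun h => hi h.2), if_neg (fun h => hi h.2)]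

/-- `hiVal j y < 2^j`. [cite: KnuthTAOCP2, §4.1] -/
theorem hiVal_lt : ∀ (j : ℕ), j ≤ ℓ → ∀ y : Fin ℓ → Bool, hiVal j y < 2 ^ j
  | 0, _, y => by simp
  | j + 1, hj, y => by
    have hj' : j < ℓ := hj
    have ih := hiVal_lt j (Nat.le_of_lt hj') y
    have h := hiVal_succ ⟨j, hj'⟩ y
    simp only at h
    rw [h, pow_succ]
    split_ifs <;> omega

/-- `binVal y < 2^ℓ`. [cite: KnuthTAOCP2, §4.1] -/
theorem binVal_lt (y : Fin ℓ → Bool) : binVal y < 2 ^ ℓ := hiVal_lt ℓ le_rfl y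

/-! ### The cell weights -/

section Cells

variable (c : ℝ) (ℓ)

/-- **The integer point of a label**: `u(y) = binVal y − 2^{ℓ-1} ∈ [−2^{ℓ-1}, 2^{ℓ-1})`. [cite: Regev2009, Lemma 3.12 (proof, eq. (10))] -/
def cellPt (y : Fin ℓ → Bool) : ℤ := (binVal y : ℤ) - 2 ^ (ℓ - 1)

/-- **The cell weight**: `w(y) = G(c, u+1) − G(c, u) = ∫_u^{u+1} e^{-ct²} dt`. [cite: Regev2009, Lemma 3.12 (proof)] -/
def cellW (y : Fin ℓ → Bool) : ℝ := gaussF c ((cellPt ℓ y : ℝ) + 1) - gaussF c (cellPt ℓ y)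

/-- The cell weight is the integral over the unit cell. [cite: Regev2009, Lemma 3.12 (proof)] -/
theorem cellW_eq_integral (y : Fin ℓ → Bool) :
    cellW ℓ c y = ∫ t in ((cellPt ℓ y : ℝ))..((cellPt ℓ y : ℝ) + 1), Real.exp (-(c * t ^ 2)) := by
  unfold cellW; rw [gaussF_sub]

/-- **Cell weights are positive.** [folklore] -/
theorem cellW_pos (y : Fin ℓ → Bool) : 0 < cellW ℓ c y := by
  rw [cellW_eq_integral]
  exact intervalIntegral.intervalIntegral_pos_of_pos ((continuous_integrand c).intervalIntegrable _ _)
    (fun t => Real.exp_pos _) (by linarith)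

/-- Cell weights are nonnegative. [folklore] -/
theorem cellW_nonneg (y : Fin ℓ → Bool) : 0 ≤ cellW ℓ c y := (cellW_pos ℓ c y).le

/-! ### Prefix masses in closed form -/

/-- **The closed form of the level-`j` prefix mass**: the Gaussian integral over the dyadic interval of
integer points `[lo − 2^{ℓ-1}, lo + 2^{ℓ-j} − 2^{ℓ-1})`, `lo = hiVal j y · 2^{ℓ-j}`. [cite: GroverRudolph2002, eq. (3)] -/
def prefG (j : ℕ) (y : Fin ℓ → Bool) : ℝ :=
  gaussF c ((hiVal j y * 2 ^ (ℓ - j) : ℕ) + (2 : ℝ) ^ (ℓ - j) - (2 : ℝ) ^ (ℓ - 1)) -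
    gaussF c ((hiVal j y * 2 ^ (ℓ - j) : ℕ) - (2 : ℝ) ^ (ℓ - 1))

/-- At level `ℓ` the closed form is the cell weight. [folklore] -/
theorem prefG_self (y : Fin ℓ → Bool) : prefG ℓ c ℓ y = cellW ℓ c y := by
  unfold prefG cellW cellPt binVal
  simp only [Nat.sub_self, pow_zero, mul_one]
  push_cast
  ring_nf

/-- **The closed form splits like the prefix mass**: `F(j, y) = F(j+1, y[j↦0]) + F(j+1, y[j↦1])`
(the two half-intervals telescope). [cite: GroverRudolph2002, eq. (3)] -/
theorem prefG_succ (j : Fin ℓ) (y : Fin ℓ → Bool) :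
    prefG ℓ c j y = prefG ℓ c (j + 1) (Function.update y j false) + prefG ℓ c (j + 1) (Function.update y j true) := by
  unfold prefG
  have hj := j.2
  -- the new prefix values
  have h0 : hiVal ((j : ℕ) + 1) (Function.update y j false) = 2 * hiVal j y := by
    have := hiVal_succ j (Function.update y j false)
    rw [Function.update_self] at this
    simp only [Bool.false_eq_true, ↓reduceIte, add_zero] at this
    rw [this, hiVal_update j le_rfl]
  have h1 : hiVal ((j : ℕ) + 1) (Function.update y j true) = 2 * hiVal j y + 1 := by
    have := hiVal_succ j (Function.update y j true)
    rw [Function.update_self] at this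
    simp only [↓reduceIte] at this
    rw [this, hiVal_update j le_rfl]
  rw [h0, h1]
  -- `2^{ℓ-j} = 2 · 2^{ℓ-j-1}`
  have hpow : (2 : ℝ) ^ (ℓ - j) = 2 * (2 : ℝ) ^ (ℓ - (j + 1)) := by
    rw [← pow_succ']; congr 1; omega
  have hpowN : (2 : ℕ) ^ (ℓ - j) = 2 * 2 ^ (ℓ - (j + 1)) := by
    rw [← pow_succ']; congr 1; omega
  -- the three evaluation points
  set A : ℝ := ((hiVal (↑j) y * 2 ^ (ℓ - ↑j) : ℕ) : ℝ) - (2 : ℝ) ^ (ℓ - 1) with hA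
  have e1 : ((2 * hiVal (↑j) y * 2 ^ (ℓ - (↑j + 1)) : ℕ) : ℝ) - (2 : ℝ) ^ (ℓ - 1) = A := by
    rw [hA]; push_cast; rw [hpow]; ring
  have e2 : ((2 * hiVal (↑j) y * 2 ^ (ℓ - (↑j + 1)) : ℕ) : ℝ) + (2 : ℝ) ^ (ℓ - (↑j + 1)) - (2 : ℝ) ^ (ℓ - 1) =
      A + (2 : ℝ) ^ (ℓ - (↑j + 1)) := by rw [hA]; push_cast; rw [hpow]; ring
  have e3 : (((2 * hiVal (↑j) y + 1) * 2 ^ (ℓ - (↑j + 1)) : ℕ) : ℝ) - (2 : ℝ) ^ (ℓ - 1) = A + (2 : ℝ) ^ (ℓ - (↑j + 1)) := by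
    rw [hA]; push_cast; rw [hpow]; ring
  have e4 : (((2 * hiVal (↑j) y + 1) * 2 ^ (ℓ - (↑j + 1)) : ℕ) : ℝ) + (2 : ℝ) ^ (ℓ - (↑j + 1)) - (2 : ℝ) ^ (ℓ - 1) =
      A + (2 : ℝ) ^ (ℓ - ↑j) := by rw [hA]; push_cast; rw [hpow]; ring
  have e5 : ((hiVal (↑j) y * 2 ^ (ℓ - ↑j) : ℕ) : ℝ) + (2 : ℝ) ^ (ℓ - ↑j) - (2 : ℝ) ^ (ℓ - 1) = A + (2 : ℝ) ^ (ℓ - ↑j) := by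
    rw [hA]; ring
  rw [e1, e2, e3, e4, e5]
  ring

/-- **The prefix mass of the cell weights in closed form**: for `j ≤ ℓ`,
`prefW (cellW ℓ c) j y = G(c, lo + 2^{ℓ-j} − 2^{ℓ-1}) − G(c, lo − 2^{ℓ-1})`, `lo = hiVal j y · 2^{ℓ-j}`.
[cite: GroverRudolph2002, eq. (3)] [cite: Regev2009, Lemma 3.12 (proof)] -/
theorem prefW_cellW : ∀ (d j : ℕ), j + d = ℓ → ∀ y : Fin ℓ → Bool, prefW (cellW ℓ c) j y = prefG ℓ c j y
  | 0, j, hj, y => by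
    rw [add_zero] at hj; subst hj
    rw [prefW_of_le _ le_rfl, prefG_self]
  | d + 1, j, hj, y => by
    have hjℓ : j < ℓ := by omega
    rw [prefW_succ (cellW ℓ c) ⟨j, hjℓ⟩ y, prefG_succ ℓ c ⟨j, hjℓ⟩ y]
    simp only
    rw [prefW_cellW d (j + 1) (by omega), prefW_cellW d (j + 1) (by omega)]

/-- The closed form at level `j ≤ ℓ`. [cite: GroverRudolph2002, eq. (3)] -/
theorem prefW_cellW_of_le {j : ℕ} (hj : j ≤ ℓ) (y : Fin ℓ → Bool) : prefW (cellW ℓ c) j y = prefG ℓ c j y :=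
  prefW_cellW ℓ c (ℓ - j) j (by omega) y

/-- **The total mass**: `W = G(c, 2^{ℓ-1}) − G(c, −2^{ℓ-1})` (for `ℓ ≥ 1`; at `ℓ = 0` the single cell
`[−1, 0)` gives `G(0) − G(−1)`). [cite: Regev2009, Lemma 3.12 (proof)] -/
theorem total_cellW (y : Fin ℓ → Bool) :
    total (cellW ℓ c) = gaussF c ((2 : ℝ) ^ ℓ - (2 : ℝ) ^ (ℓ - 1)) - gaussF c (-(2 : ℝ) ^ (ℓ - 1)) := by
  rw [← prefW_zero (cellW ℓ c) y, prefW_cellW_of_le ℓ c (Nat.zero_le _), prefG]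
  simp

/-- The total mass is positive. [folklore] -/
theorem total_cellW_pos [Nonempty (Fin ℓ → Bool)] : 0 < total (cellW ℓ c) := by
  unfold total
  exact sum_pos (fun y _ => cellW_pos ℓ c y) univ_nonempty

end Cells

end GaussianCells

end Literature.Computability.QuantumComplexity

end
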